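import Literature.NumberTheory.Automorphic.UnitaryResiduallyRegularNonsplitPlace
import Literature.NumberTheory.Automorphic.UnramifiedOrbitSetSplit
import Literature.NumberTheory.Automorphic.UnramifiedOrbitSetNonsplit
import Literature.NumberTheory.Automorphic.GLnResiduallyRegularConjugacy
import Literature.NumberTheory.Automorphic.UnitaryGroupLocalCongr
import Literature.NumberTheory.Automorphic.LocalUnitaryIntegralLevel
import Literature.NumberTheory.Automorphic.AdelicUnitaryGroupDatum
import HarnessLib

/-!
# Residual separability of the characteristic polynomial at almost every place

(Kottwitz (1986), Prop. 7.1, Cor. 7.3; Platonov–Rapinchuk (1994), §5.1.)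

Topic `NumberTheory/Automorphic`; namespaces `Literature.NumberTheory.Automorphic.GLn` (§1–§2) and
`Literature.NumberTheory.Automorphic.UnitaryGroup` (§3–§4).  THEOREMS ONLY (no definition, no named fact, no `sorry`, no
instance, no notation).  Cell `pub/hodgecm-mathlib`, P3a, brick **«D-S3u a.e.-v BRIDGE»** (LEAD F0P3a-plan (g9) WORD T8-2 (7)(b)).

The tree carries TWO idioms for «`γ_w ∈ GL_N(𝒪_w)` is residually regular»:

* the **`∃ q` idiom** of ★ `integralConj_unitaryGroupOfForm` ∕ ★ `orbitSet_of_split`: an integral model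
  `q ∈ 𝒪_w[X]` (Mathlib's `w.adicCompletionIntegers E`) of `charpoly γ_w` with `q mod 𝔪_w` separable — the idiom in which the tree's
  ALMOST-EVERY-PLACE results are stated (★ `eventually_exists_separable_lift`: a separable `p ∈ E[X]` has such a model at
  almost every `w`);
* the **`redMat` idiom** of ★ `GLn.exists_mem_glInt_conj_eq_of_charpoly_eq_of_separable_redMat` (B-p14 (g29)): the entrywise
  reduction `redMat γ_w ∈ M_N(𝓀_w)` (★ `IntegralReduction.redMat`, `ValuativeRel` integers `𝒪[E_w]`) has separable characteristic
  polynomial — the binder `hsep` of the CLOSED unit-orbital-integral heads ★ `UnitaryResiduallyRegularOrbitalIntegralClosed` (A-p01 (g20),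
  split places), ★ `ResiduallyRegularOrbitalIntegralClosed` (F0P3b-p01 (g5), `GL_n`), ★ `UnitaryResiduallyRegularNonsplitPlace` (A-p03 (g23),
  non-split places).

★ `UnitaryGroup.exists_integral_lift_separable_of_separable_redMat` is the bridge `redMat ⟹ ∃ q`.  This file supplies the CONVERSE
bridge and, through it, the `redMat` binder AT ALMOST EVERY PLACE:

* §1 `GLn.separable_redMat_of_exists_integral_lift` (`∃ q ⟹ redMat`), `GLn.separable_redMat_iff_exists_integral_lift`;
* §2 `GLn.eventually_forall_separable_redMat_of_charpoly_eq` — for a separable `p ∈ E[X]`, at almost every place `w` of `E`, EVERY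
  `g ∈ GL_N(𝒪_w)` with `charpoly g = p ⊗ 1` has `(redMat g).charpoly` separable (the exceptional set depends on `p` only);
  `GLn.eventually_mem_glInt_and_separable_redMat` — for `γ ∈ GL_N(E)` with separable characteristic polynomial, `γ_w ∈ GL_N(𝒪_w)` and
  `redMat γ_w` is residually separable at almost every `w`; both regrouped over the places `v` of a subfield `F`
  (★ `eventually_forall_placesOver`);
* §3 the unitary dress: for `γ ∈ GL_N(E)` with `γ ⊗ 1 ∈ U(J)(F_v)` for all `v` (`hg : ↑(g v) = toLocalGL E v γ`), at almost every place `v`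
  of `F`: `g v ∈ U(J)(𝒪_v)` (★ `localIntegralLevel`; `eventually_mem_localIntegralLevel_of_eq_toLocalGL`), and for every `w ∣ v` the
  `GL_N(E_w)`-avatar of `g v` — ★ `localSplitEquiv` at a split `w`, ★ `localNonsplitEquiv` at a non-split `w` — lies in `GL_N(𝒪_w)`, has separable
  characteristic polynomial, and has residually separable reduction (`eventually_forall_separable_redMat_localSplitEquiv` ∕ `…_localNonsplitEquiv`);
  and the polynomial-keyed forms for ARBITRARY `g ∈ U(J)(𝒪_v)` with prescribed characteristic polynomial of the avatar
  (`eventually_forall_separable_redMat_localSplitEquiv_of_charpoly_eq` ∕ `…_localNonsplitEquiv_of_charpoly_eq`) — the shape the CLASS-level heads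
  consume (`Quotient.out c` shares the characteristic polynomial of `γ`);
* §4 the CM dress over ★ `cmDatum L N H` ∕ ★ `cmLocalIntegralLevel` (binders `hc`, `hH`, `hw`, `hHw`, `hHi` token for token with ★
  `UnitaryResiduallyRegularOrbitalIntegralClosed`): for a rational `γ ∈ U(H)(L⁺)` with separable characteristic polynomial, at almost every `v`,
  `γ_v = toLocal v (toAdelic γ) ∈ U(H)(𝒪_v)` (`eventually_toLocal_toAdelic_mem_cmLocalIntegralLevel`) and its split ∕ non-split avatars are integral,
  regular and residually regular (`eventually_forall_separable_redMat_localSplitEquiv_toLocal_toAdelic` ∕ `…_localNonsplitEquiv_toLocal_toAdelic`);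
  polynomial-keyed forms `…_cmDatum_of_charpoly_eq`.

Tree-absence census (2026-09-01): `rg "separable_redMat_of|eventually_separable_redMat|eventually.*redMat|redMat.*cofinite"` → one CONSUMER head
(`GLn.orbitalIntegral_indicator_glInt_eq_of_separable_redMat_of_compactCore`), no producer; `rg "eventually.*mem_localIntegralLevel"` → 0.

## References
* [Kottwitz1986] R. E. Kottwitz, *Stable trace formula: elliptic singular terms*, Math. Ann. 275 (1986), Prop. 7.1, Cor. 7.3.
* [PlatonovRapinchuk1994] V. Platonov, A. Rapinchuk, *Algebraic Groups and Number Theory* (1994), §5.1.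
-/

set_option autoImplicit false

noncomputable section

open Set Filter NumberField IsDedekindDomain Polynomial ValuativeRel
open scoped Matrix MatrixGroups ValuativeRel

namespace Literature.NumberTheory.Automorphic

open Literature.NumberTheory.Automorphic.IntegralReduction

/-! ## §1 The converse bridge: `∃ q ⟹ redMat` -/

namespace GLn

section Bridge

variable {E : Type} [Field E] [NumberField E] (N : ℕ) (w : HeightOneSpectrum (𝓞 E))

/-- **`∃ q ⟹ redMat`**: for `g ∈ GL_N(𝒪_w)` (★ `glInt`) whose characteristic polynomial has an integral model `q ∈ 𝒪_w[X]` (Mathlib's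
`w.adicCompletionIntegers E`) separable modulo `𝔪_w`, the characteristic polynomial of the reduced matrix `redMat g ∈ M_N(𝓀_w)` is separable:
`q` is THE characteristic polynomial of the integral matrix (`𝒪_w ↪ E_w` is injective; ★ `integer_valuation_eq_adicCompletionIntegers` identifies
the two integer rings) and `(redMat g).charpoly` is its reduction (★ `GLn.charpoly_redMat_map_eq`). [cite: Kottwitz1986, Prop. 7.1] -/
theorem separable_redMat_of_exists_integral_lift (g : GL (Fin N) (w.adicCompletion E)) (hg : g ∈ glInt N (w.adicCompletion E))
    (h : ∃ q : (w.adicCompletionIntegers E)[X],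
      q.map (w.adicCompletionIntegers E).subtype = (g : Matrix (Fin N) (Fin N) (w.adicCompletion E)).charpoly ∧
        (q.map (IsLocalRing.residue (w.adicCompletionIntegers E))).Separable) :
    (redMat (g : Matrix (Fin N) (Fin N) (w.adicCompletion E))).charpoly.Separable := by
  obtain ⟨gO, rfl⟩ := hg
  obtain ⟨q, hq, hqsep⟩ := h
  let e : 𝒪[w.adicCompletion E] ≃+* w.adicCompletionIntegers E :=
    RingEquiv.subringCongr (integer_valuation_eq_adicCompletionIntegers w)
  have hcomp : (𝒪[w.adicCompletion E]).subtype.comp (e.symm : w.adicCompletionIntegers E →+* 𝒪[w.adicCompletion E]) =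
      (w.adicCompletionIntegers E).subtype :=
    RingHom.ext fun _ => rfl
  have hq' : q.map (e.symm : w.adicCompletionIntegers E →+* 𝒪[w.adicCompletion E]) = (gO : Matrix (Fin N) (Fin N) 𝒪[w.adicCompletion E]).charpoly := by
    apply Polynomial.map_injective (𝒪[w.adicCompletion E]).subtype Subtype.val_injective
    rw [Polynomial.map_map, hcomp, hq, ← Matrix.charpoly_map]
    rfl
  rw [GLn.charpoly_redMat_map_eq, ← hq', Polynomial.map_map, ← IsLocalRing.ResidueField.map_comp_residue, ← Polynomial.map_map]
  exact hqsep.map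

/-- **`redMat ⟺ ∃ q`** for `g ∈ GL_N(𝒪_w)`: the two residual-separability idioms of the tree agree (§1 and ★
`UnitaryGroup.exists_integral_lift_separable_of_separable_redMat`). [cite: Kottwitz1986, Prop. 7.1] -/
theorem separable_redMat_iff_exists_integral_lift {F : Type} [Field F] [Algebra F E] {v : HeightOneSpectrum (𝓞 F)} (w : UnitaryGroup.PlacesOver E v)
    (g : GL (Fin N) (w.1.adicCompletion E)) (hg : g ∈ glInt N (w.1.adicCompletion E)) :
    (redMat (g : Matrix (Fin N) (Fin N) (w.1.adicCompletion E))).charpoly.Separable ↔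
      ∃ q : (w.1.adicCompletionIntegers E)[X],
        q.map (w.1.adicCompletionIntegers E).subtype = (g : Matrix (Fin N) (Fin N) (w.1.adicCompletion E)).charpoly ∧
          (q.map (IsLocalRing.residue (w.1.adicCompletionIntegers E))).Separable :=
  ⟨UnitaryGroup.exists_integral_lift_separable_of_separable_redMat N w g hg, separable_redMat_of_exists_integral_lift N w.1 g hg⟩

end Bridge

/-! ## §2 Almost every place of `E`: the `redMat` binder for `GL_N` -/

section AE

variable {E : Type} [Field E] [NumberField E] (N : ℕ)

/-- **Residual separability at almost every place, polynomial-keyed**: for a separable `p ∈ E[X]`, for all but finitely many places `w` of `E`,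
EVERY `g ∈ GL_N(𝒪_w)` whose characteristic polynomial is `p ⊗ 1` has residually separable reduction — the exceptional set (where `p` has no
separable integral model, ★ `eventually_exists_separable_lift`) depends on `p` only. [cite: Kottwitz1986, Cor. 7.3] -/
theorem eventually_forall_separable_redMat_of_charpoly_eq (p : E[X]) (hp : p.Separable) :
    ∀ᶠ w : HeightOneSpectrum (𝓞 E) in cofinite, ∀ g : GL (Fin N) (w.adicCompletion E), g ∈ glInt N (w.adicCompletion E) →
      (g : Matrix (Fin N) (Fin N) (w.adicCompletion E)).charpoly = p.map (algebraMap E (w.adicCompletion E)) →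
        (redMat (g : Matrix (Fin N) (Fin N) (w.adicCompletion E))).charpoly.Separable := by
  filter_upwards [eventually_exists_separable_lift p hp] with w hw g hg hchar
  obtain ⟨q, hq, hqsep⟩ := hw
  exact separable_redMat_of_exists_integral_lift N w g hg ⟨q, hq.trans hchar.symm, hqsep.map⟩

/-- The characteristic polynomial of `γ ⊗ 1 ∈ GL_N(E_w)` is `(charpoly γ) ⊗ 1`. [cite: PlatonovRapinchuk1994, §5.1] -/
theorem charpoly_map_algebraMap (γ : GL (Fin N) E) (w : HeightOneSpectrum (𝓞 E)) :
    ((Matrix.GeneralLinearGroup.map (algebraMap E (w.adicCompletion E)) γ : GL (Fin N) (w.adicCompletion E)) :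
        Matrix (Fin N) (Fin N) (w.adicCompletion E)).charpoly =
      (γ : Matrix (Fin N) (Fin N) E).charpoly.map (algebraMap E (w.adicCompletion E)) := by
  rw [← Matrix.charpoly_map]
  rfl

/-- **Residual regularity at almost every place, for a rational element**: for `γ ∈ GL_N(E)` with separable characteristic polynomial, for all but
finitely many places `w` of `E`, `γ_w ∈ GL_N(𝒪_w)` (★ `GLn.eventually_evalAt_mem_glInt`) and `redMat γ_w` has separable characteristic polynomial.
[cite: Kottwitz1986, Cor. 7.3] [cite: PlatonovRapinchuk1994, §5.1] -/
theorem eventually_mem_glInt_and_separable_redMat (γ : GL (Fin N) E) (hγ : (γ : Matrix (Fin N) (Fin N) E).charpoly.Separable) :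
    ∀ᶠ w : HeightOneSpectrum (𝓞 E) in cofinite,
      Matrix.GeneralLinearGroup.map (algebraMap E (w.adicCompletion E)) γ ∈ glInt N (w.adicCompletion E) ∧
        (redMat ((Matrix.GeneralLinearGroup.map (algebraMap E (w.adicCompletion E)) γ : GL (Fin N) (w.adicCompletion E)) :
          Matrix (Fin N) (Fin N) (w.adicCompletion E))).charpoly.Separable := by
  filter_upwards [GLn.eventually_evalAt_mem_glInt (UnitaryGroup.toFinAdeleGL E N γ),
    eventually_forall_separable_redMat_of_charpoly_eq N _ hγ] with w hint hsep
  rw [UnitaryGroup.evalAt_toFinAdeleGL] at hint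
  exact ⟨hint, hsep _ hint (charpoly_map_algebraMap N γ w)⟩

variable (F : Type) [Field F] [Algebra F E]

/-- §2 polynomial-keyed, regrouped over the places `v` of a subfield `F` (★ `eventually_forall_placesOver`). [cite: Kottwitz1986, Cor. 7.3] -/
theorem eventually_forall_placesOver_separable_redMat_of_charpoly_eq (p : E[X]) (hp : p.Separable) :
    ∀ᶠ v : HeightOneSpectrum (𝓞 F) in cofinite, ∀ w : UnitaryGroup.PlacesOver E v,
      ∀ g : GL (Fin N) (w.1.adicCompletion E), g ∈ glInt N (w.1.adicCompletion E) →
        (g : Matrix (Fin N) (Fin N) (w.1.adicCompletion E)).charpoly = p.map (algebraMap E (w.1.adicCompletion E)) →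
          (redMat (g : Matrix (Fin N) (Fin N) (w.1.adicCompletion E))).charpoly.Separable :=
  UnitaryGroup.eventually_forall_placesOver E (eventually_forall_separable_redMat_of_charpoly_eq N p hp)

/-- §2 for a rational `γ`, regrouped over the places `v` of a subfield `F`. [cite: Kottwitz1986, Cor. 7.3] [cite: PlatonovRapinchuk1994, §5.1] -/
theorem eventually_forall_placesOver_mem_glInt_and_separable_redMat (γ : GL (Fin N) E)
    (hγ : (γ : Matrix (Fin N) (Fin N) E).charpoly.Separable) :
    ∀ᶠ v : HeightOneSpectrum (𝓞 F) in cofinite, ∀ w : UnitaryGroup.PlacesOver E v,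
      Matrix.GeneralLinearGroup.map (algebraMap E (w.1.adicCompletion E)) γ ∈ glInt N (w.1.adicCompletion E) ∧
        (redMat ((Matrix.GeneralLinearGroup.map (algebraMap E (w.1.adicCompletion E)) γ : GL (Fin N) (w.1.adicCompletion E)) :
          Matrix (Fin N) (Fin N) (w.1.adicCompletion E))).charpoly.Separable :=
  UnitaryGroup.eventually_forall_placesOver E (eventually_mem_glInt_and_separable_redMat N γ hγ)

end AE

end GLn

/-! ## §3 The unitary dress: `U(J)(F_v)` through ★ `localSplitEquiv` ∕ ★ `localNonsplitEquiv` -/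

namespace UnitaryGroup

section Unitary

variable {F E : Type} [Field F] [NumberField F] [Field E] [NumberField E] [Algebra F E]
  [Algebra.IsQuadraticExtension F E]
  (c : E ≃ₐ[F] E) (N : ℕ) (J : Matrix (Fin N) (Fin N) E) (hc : c ≠ 1) (hJh : (J.map c)ᵀ = J)

include hc hJh in
/-- **`γ ⊗ 1 ∈ U(J)(𝒪_v)` at almost every place**: for `det J` a unit and `γ ∈ GL_N(E)` with `γ ⊗ 1 ∈ U(J)(F_v)` for all `v` (the elements `g v`,
`hg`), `g v ∈ K_v = U(J)(𝒪_v)` (★ `localIntegralLevel`) for all but finitely many `v` — off the places where `J_w` or `γ_w` is not in `GL_N(𝒪_w)`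
(★ `eventually_forall_unit_placeForm_mem_glInt`, ★ `eventually_forall_map_mem_glInt`), by the level matchings ★ `mem_localIntegralLevel_iff_of_ne` (split)
∕ ★ `mem_localIntegralLevel_iff_of_smul_eq` (non-split). [cite: PlatonovRapinchuk1994, §5.1] -/
theorem eventually_mem_localIntegralLevel_of_eq_toLocalGL (hJ : IsUnit J.det) (γ : GL (Fin N) E)
    (g : ∀ v : HeightOneSpectrum (𝓞 F), «local» E c N J v) (hg : ∀ v, (g v : GL (Fin N) (LocalRing E v)) = toLocalGL E v γ) :
    ∀ᶠ v : HeightOneSpectrum (𝓞 F) in cofinite, g v ∈ localIntegralLevel c N J v := by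
  have hJu : IsUnit J := (Matrix.isUnit_iff_isUnit_det J).2 hJ
  filter_upwards [eventually_forall_unit_placeForm_mem_glInt (F := F) N J hJu, eventually_forall_map_mem_glInt F E γ] with v hint hγint
  obtain ⟨w⟩ := (inferInstance : Nonempty (PlacesOver E v))
  by_cases hw : c • w.1 = w.1
  · rw [mem_localIntegralLevel_iff_of_smul_eq c N J hc w hw, localNonsplitEquiv_eq_map_of_eq_toLocalGL c N J hc w hw γ (g v) (hg v)]
    exact hγint w
  · rw [mem_localIntegralLevel_iff_of_ne c N J hc hJh w hw (isUnit_placeForm J hJu w.1) (hint w),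
      localSplitEquiv_eq_map_of_eq_toLocalGL c N J hc hJh w hw (isUnit_placeForm J hJu w.1) γ (g v) (hg v)]
    exact hγint w

/-- **SPLIT avatar of a rational `γ`, at almost every place**: for `γ ∈ GL_N(E)` with separable characteristic polynomial and `γ ⊗ 1 ∈ U(J)(F_v)` for
all `v`, for all but finitely many `v` and every split `w ∣ v` (`c • w ≠ w`), the avatar `e (g v) ∈ GL_N(E_w)` (`e` = ★ `localSplitEquiv`, which reads
`γ ⊗ 1` as `γ`, ★ `localSplitEquiv_eq_map_of_eq_toLocalGL`) lies in `GL_N(𝒪_w)`, has separable characteristic polynomial, and has residually separable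
reduction — the binders `hγs`, `hsep` of ★ `classOrbitalIntegral_indicator_cmLocalIntegralLevel_eq_one_of_isCanonical_of_split`, a.e. in `v`.
[cite: Kottwitz1986, Cor. 7.3] [cite: PlatonovRapinchuk1994, §5.1] -/
theorem eventually_forall_separable_redMat_localSplitEquiv (γ : GL (Fin N) E) (hγ : (γ : Matrix (Fin N) (Fin N) E).charpoly.Separable)
    (g : ∀ v : HeightOneSpectrum (𝓞 F), «local» E c N J v) (hg : ∀ v, (g v : GL (Fin N) (LocalRing E v)) = toLocalGL E v γ) :
    ∀ᶠ v : HeightOneSpectrum (𝓞 F) in cofinite, ∀ w : PlacesOver E v, ∀ (hw : c • w.1 ≠ w.1) (hJw : IsUnit (placeForm J w.1)),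
      localSplitEquiv c J hc hJh w hw hJw (g v) ∈ glInt N (w.1.adicCompletion E) ∧
        ((localSplitEquiv c J hc hJh w hw hJw (g v) : GL (Fin N) (w.1.adicCompletion E)) :
            Matrix (Fin N) (Fin N) (w.1.adicCompletion E)).charpoly.Separable ∧
          (redMat ((localSplitEquiv c J hc hJh w hw hJw (g v) : GL (Fin N) (w.1.adicCompletion E)) :
            Matrix (Fin N) (Fin N) (w.1.adicCompletion E))).charpoly.Separable := by
  filter_upwards [GLn.eventually_forall_placesOver_mem_glInt_and_separable_redMat N F γ hγ] with v hv w hw hJw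
  rw [localSplitEquiv_eq_map_of_eq_toLocalGL c N J hc hJh w hw hJw γ (g v) (hg v), GLn.charpoly_map_algebraMap]
  exact ⟨(hv w).1, hγ.map, (hv w).2⟩

/-- **NON-SPLIT avatar of a rational `γ`, at almost every place**: the same at every non-split `w ∣ v` (`c • w = w`) for the one-place model
`e (g v) ∈ U(σ_w, J_w)(E_w) ≤ GL_N(E_w)` (`e` = ★ `localNonsplitEquiv`, ★ `localNonsplitEquiv_eq_map_of_eq_toLocalGL`) — the binders of ★
`UnitaryGroup.setOf_mem_localIntegralLevel_eq_compactCore_centralizer_of_nonsplit` ∕ `…_conj_eq_of_isConj_of_separable_redMat`, a.e. in `v`.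
[cite: Kottwitz1986, Cor. 7.3] [cite: PlatonovRapinchuk1994, §5.1] -/
theorem eventually_forall_separable_redMat_localNonsplitEquiv (γ : GL (Fin N) E) (hγ : (γ : Matrix (Fin N) (Fin N) E).charpoly.Separable)
    (g : ∀ v : HeightOneSpectrum (𝓞 F), «local» E c N J v) (hg : ∀ v, (g v : GL (Fin N) (LocalRing E v)) = toLocalGL E v γ) :
    ∀ᶠ v : HeightOneSpectrum (𝓞 F) in cofinite, ∀ w : PlacesOver E v, ∀ (hw : c • w.1 = w.1),
      ((localNonsplitEquiv c J hc w hw (g v) : unitaryGroupOfForm (galAdicCompletionMap (L := E) c hw) (placeForm J w.1)) :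
          GL (Fin N) (w.1.adicCompletion E)) ∈ glInt N (w.1.adicCompletion E) ∧
        (((localNonsplitEquiv c J hc w hw (g v) : unitaryGroupOfForm (galAdicCompletionMap (L := E) c hw) (placeForm J w.1)) :
            GL (Fin N) (w.1.adicCompletion E)) : Matrix (Fin N) (Fin N) (w.1.adicCompletion E)).charpoly.Separable ∧
          (redMat (((localNonsplitEquiv c J hc w hw (g v) : unitaryGroupOfForm (galAdicCompletionMap (L := E) c hw) (placeForm J w.1)) :
            GL (Fin N) (w.1.adicCompletion E)) : Matrix (Fin N) (Fin N) (w.1.adicCompletion E))).charpoly.Separable := by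
  filter_upwards [GLn.eventually_forall_placesOver_mem_glInt_and_separable_redMat N F γ hγ] with v hv w hw
  rw [localNonsplitEquiv_eq_map_of_eq_toLocalGL c N J hc w hw γ (g v) (hg v), GLn.charpoly_map_algebraMap]
  exact ⟨(hv w).1, hγ.map, (hv w).2⟩

/-- **SPLIT avatar, polynomial-keyed**: for a separable `p ∈ E[X]`, for all but finitely many `v`, at every split `w ∣ v` of good reduction (`J_w ∈ GL_N(𝒪_w)`),
EVERY `g ∈ U(J)(𝒪_v)` whose avatar has characteristic polynomial `p ⊗ 1` has residually separable reduction (★ `mem_localIntegralLevel_iff_of_ne` puts the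
avatar in `GL_N(𝒪_w)`) — the form the CLASS-level heads consume (`Quotient.out c ∈ K_v` shares `γ`'s characteristic polynomial). [cite: Kottwitz1986, Cor. 7.3] -/
theorem eventually_forall_separable_redMat_localSplitEquiv_of_charpoly_eq (p : E[X]) (hp : p.Separable) :
    ∀ᶠ v : HeightOneSpectrum (𝓞 F) in cofinite, ∀ w : PlacesOver E v, ∀ (hw : c • w.1 ≠ w.1) (hJw : IsUnit (placeForm J w.1)),
      hJw.unit ∈ glInt N (w.1.adicCompletion E) → ∀ g ∈ localIntegralLevel c N J v,
        ((localSplitEquiv c J hc hJh w hw hJw g : GL (Fin N) (w.1.adicCompletion E)) :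
            Matrix (Fin N) (Fin N) (w.1.adicCompletion E)).charpoly = p.map (algebraMap E (w.1.adicCompletion E)) →
          (redMat ((localSplitEquiv c J hc hJh w hw hJw g : GL (Fin N) (w.1.adicCompletion E)) :
            Matrix (Fin N) (Fin N) (w.1.adicCompletion E))).charpoly.Separable := by
  filter_upwards [GLn.eventually_forall_placesOver_separable_redMat_of_charpoly_eq N F p hp] with v hv w hw hJw hJi g hg hchar
  exact hv w _ ((mem_localIntegralLevel_iff_of_ne c N J hc hJh w hw hJw hJi g).1 hg) hchar

/-- **NON-SPLIT avatar, polynomial-keyed**: for a separable `p ∈ E[X]`, for all but finitely many `v`, at every non-split `w ∣ v`, EVERY `g ∈ U(J)(𝒪_v)`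
whose one-place avatar has characteristic polynomial `p ⊗ 1` has residually separable reduction (★ `mem_localIntegralLevel_iff_of_smul_eq`).
[cite: Kottwitz1986, Cor. 7.3] -/
theorem eventually_forall_separable_redMat_localNonsplitEquiv_of_charpoly_eq (p : E[X]) (hp : p.Separable) :
    ∀ᶠ v : HeightOneSpectrum (𝓞 F) in cofinite, ∀ w : PlacesOver E v, ∀ (hw : c • w.1 = w.1), ∀ g ∈ localIntegralLevel c N J v,
      (((localNonsplitEquiv c J hc w hw g : unitaryGroupOfForm (galAdicCompletionMap (L := E) c hw) (placeForm J w.1)) :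
          GL (Fin N) (w.1.adicCompletion E)) : Matrix (Fin N) (Fin N) (w.1.adicCompletion E)).charpoly =
            p.map (algebraMap E (w.1.adicCompletion E)) →
        (redMat (((localNonsplitEquiv c J hc w hw g : unitaryGroupOfForm (galAdicCompletionMap (L := E) c hw) (placeForm J w.1)) :
          GL (Fin N) (w.1.adicCompletion E)) : Matrix (Fin N) (Fin N) (w.1.adicCompletion E))).charpoly.Separable := by
  filter_upwards [GLn.eventually_forall_placesOver_separable_redMat_of_charpoly_eq N F p hp] with v hv w hw g hg hchar
  exact hv w _ ((mem_localIntegralLevel_iff_of_smul_eq c N J hc w hw g).1 hg) hchar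

end Unitary

/-! ## §4 The CM dress: `(cmDatum L N H).Local v`, `cmLocalIntegralLevel`, rational `γ ∈ U(H)(L⁺)` -/

section CM

variable (L : Type) [Field L] [NumberField L] [IsCMField L] (N : ℕ) (H : Matrix (Fin N) (Fin N) L)
  (hc : IsCMField.complexConj L ≠ 1) (hH : (H.map (IsCMField.complexConj L))ᵀ = H)

include hc hH in
/-- **CM: `γ_v ∈ U(H)(𝒪_v)` at almost every place** of `L⁺`, for `H` hermitian with `det H ≠ 0` and a rational `γ ∈ U(H)(L⁺)` (its local component
`γ_v = toLocal v (toAdelic γ) = γ ⊗ 1`, ★ `coe_cmDatum_toLocal_toAdelic`; ★ `cmLocalIntegralLevel`; §3 in the CM dress). [cite: PlatonovRapinchuk1994, §5.1] -/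
theorem eventually_toLocal_toAdelic_mem_cmLocalIntegralLevel (hHd : H.det ≠ 0) (γ : (cmDatum L N H).Rational) :
    ∀ᶠ v : HeightOneSpectrum (𝓞 ↥(maximalRealSubfield L)) in cofinite,
      (cmDatum L N H).toLocal v ((cmDatum L N H).toAdelic γ) ∈ cmLocalIntegralLevel L N H v :=
  eventually_mem_localIntegralLevel_of_eq_toLocalGL (IsCMField.complexConj L) N H hc hH (isUnit_iff_ne_zero.2 hHd) (γ.val : GL (Fin N) L)
    (fun v => (cmDatum L N H).toLocal v ((cmDatum L N H).toAdelic γ)) (fun v => coe_cmDatum_toLocal_toAdelic L N H v γ)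

/-- **CM, SPLIT avatar of a rational regular semisimple `γ ∈ U(H)(L⁺)` at almost every place**: the binders `hγs`, `hsep` of ★
`classOrbitalIntegral_indicator_cmLocalIntegralLevel_eq_one_of_isCanonical_of_split` at `γ_v`, together with `e γ_v ∈ GL_N(𝒪_w)`, for all but finitely many
`v` and every split `w ∣ v`. [cite: Kottwitz1986, Cor. 7.3] [cite: PlatonovRapinchuk1994, §5.1] -/
theorem eventually_forall_separable_redMat_localSplitEquiv_toLocal_toAdelic (γ : (cmDatum L N H).Rational)
    (hγ : (((γ.val : GL (Fin N) L) : Matrix (Fin N) (Fin N) L).charpoly).Separable) :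
    ∀ᶠ v : HeightOneSpectrum (𝓞 ↥(maximalRealSubfield L)) in cofinite, ∀ w : PlacesOver L v,
      ∀ (hw : IsCMField.complexConj L • w.1 ≠ w.1) (hHw : IsUnit (placeForm H w.1)),
        localSplitEquiv (IsCMField.complexConj L) H hc hH w hw hHw ((cmDatum L N H).toLocal v ((cmDatum L N H).toAdelic γ)) ∈
            glInt N (w.1.adicCompletion L) ∧
          ((localSplitEquiv (IsCMField.complexConj L) H hc hH w hw hHw ((cmDatum L N H).toLocal v ((cmDatum L N H).toAdelic γ)) :
              GL (Fin N) (w.1.adicCompletion L)) : Matrix (Fin N) (Fin N) (w.1.adicCompletion L)).charpoly.Separable ∧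
            (redMat ((localSplitEquiv (IsCMField.complexConj L) H hc hH w hw hHw ((cmDatum L N H).toLocal v ((cmDatum L N H).toAdelic γ)) :
              GL (Fin N) (w.1.adicCompletion L)) : Matrix (Fin N) (Fin N) (w.1.adicCompletion L))).charpoly.Separable :=
  eventually_forall_separable_redMat_localSplitEquiv (IsCMField.complexConj L) N H hc hH (γ.val : GL (Fin N) L) hγ
    (fun v => (cmDatum L N H).toLocal v ((cmDatum L N H).toAdelic γ)) (fun v => coe_cmDatum_toLocal_toAdelic L N H v γ)

/-- **CM, NON-SPLIT avatar of a rational regular semisimple `γ ∈ U(H)(L⁺)` at almost every place**: the binders of ★ `UnitaryResiduallyRegularNonsplitPlace`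
(w1)(w2) at `γ_v`, for all but finitely many `v` and every non-split `w ∣ v`. [cite: Kottwitz1986, Cor. 7.3] [cite: PlatonovRapinchuk1994, §5.1] -/
theorem eventually_forall_separable_redMat_localNonsplitEquiv_toLocal_toAdelic (γ : (cmDatum L N H).Rational)
    (hγ : (((γ.val : GL (Fin N) L) : Matrix (Fin N) (Fin N) L).charpoly).Separable) :
    ∀ᶠ v : HeightOneSpectrum (𝓞 ↥(maximalRealSubfield L)) in cofinite, ∀ w : PlacesOver L v,
      ∀ (hw : IsCMField.complexConj L • w.1 = w.1),
        ((localNonsplitEquiv (IsCMField.complexConj L) H hc w hw ((cmDatum L N H).toLocal v ((cmDatum L N H).toAdelic γ)) :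
            unitaryGroupOfForm (galAdicCompletionMap (L := L) (IsCMField.complexConj L) hw) (placeForm H w.1)) :
              GL (Fin N) (w.1.adicCompletion L)) ∈ glInt N (w.1.adicCompletion L) ∧
          (((localNonsplitEquiv (IsCMField.complexConj L) H hc w hw ((cmDatum L N H).toLocal v ((cmDatum L N H).toAdelic γ)) :
              unitaryGroupOfForm (galAdicCompletionMap (L := L) (IsCMField.complexConj L) hw) (placeForm H w.1)) :
                GL (Fin N) (w.1.adicCompletion L)) : Matrix (Fin N) (Fin N) (w.1.adicCompletion L)).charpoly.Separable ∧
            (redMat (((localNonsplitEquiv (IsCMField.complexConj L) H hc w hw ((cmDatum L N H).toLocal v ((cmDatum L N H).toAdelic γ)) :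
              unitaryGroupOfForm (galAdicCompletionMap (L := L) (IsCMField.complexConj L) hw) (placeForm H w.1)) :
                GL (Fin N) (w.1.adicCompletion L)) : Matrix (Fin N) (Fin N) (w.1.adicCompletion L))).charpoly.Separable :=
  eventually_forall_separable_redMat_localNonsplitEquiv (IsCMField.complexConj L) N H hc (γ.val : GL (Fin N) L) hγ
    (fun v => (cmDatum L N H).toLocal v ((cmDatum L N H).toAdelic γ)) (fun v => coe_cmDatum_toLocal_toAdelic L N H v γ)

/-- **CM, SPLIT avatar, polynomial-keyed**: for a separable `p ∈ L[X]`, for all but finitely many `v`, at every split `w ∣ v` of good reduction, EVERY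
`g ∈ U(H)(𝒪_v)` whose avatar has characteristic polynomial `p ⊗ 1` has residually separable reduction — `hsep` of ★
`classOrbitalIntegral_indicator_cmLocalIntegralLevel_eq_one_of_isCanonical_of_split` from `hγ` and the characteristic polynomial alone. [cite: Kottwitz1986, Cor. 7.3] -/
theorem eventually_forall_separable_redMat_localSplitEquiv_cmDatum_of_charpoly_eq (p : L[X]) (hp : p.Separable) :
    ∀ᶠ v : HeightOneSpectrum (𝓞 ↥(maximalRealSubfield L)) in cofinite, ∀ w : PlacesOver L v,
      ∀ (hw : IsCMField.complexConj L • w.1 ≠ w.1) (hHw : IsUnit (placeForm H w.1)), hHw.unit ∈ glInt N (w.1.adicCompletion L) →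
        ∀ g : (cmDatum L N H).Local v, g ∈ cmLocalIntegralLevel L N H v →
          ((localSplitEquiv (IsCMField.complexConj L) H hc hH w hw hHw g : GL (Fin N) (w.1.adicCompletion L)) :
              Matrix (Fin N) (Fin N) (w.1.adicCompletion L)).charpoly = p.map (algebraMap L (w.1.adicCompletion L)) →
            (redMat ((localSplitEquiv (IsCMField.complexConj L) H hc hH w hw hHw g : GL (Fin N) (w.1.adicCompletion L)) :
              Matrix (Fin N) (Fin N) (w.1.adicCompletion L))).charpoly.Separable :=
  eventually_forall_separable_redMat_localSplitEquiv_of_charpoly_eq (IsCMField.complexConj L) N H hc hH p hp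

/-- **CM, NON-SPLIT avatar, polynomial-keyed**: the same at every non-split `w ∣ v` for the one-place avatar — `hsep` of ★
`UnitaryResiduallyRegularNonsplitPlace` (w1)(w2) from the characteristic polynomial alone. [cite: Kottwitz1986, Cor. 7.3] -/
theorem eventually_forall_separable_redMat_localNonsplitEquiv_cmDatum_of_charpoly_eq (p : L[X]) (hp : p.Separable) :
    ∀ᶠ v : HeightOneSpectrum (𝓞 ↥(maximalRealSubfield L)) in cofinite, ∀ w : PlacesOver L v,
      ∀ (hw : IsCMField.complexConj L • w.1 = w.1), ∀ g : (cmDatum L N H).Local v, g ∈ cmLocalIntegralLevel L N H v →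
        (((localNonsplitEquiv (IsCMField.complexConj L) H hc w hw g :
            unitaryGroupOfForm (galAdicCompletionMap (L := L) (IsCMField.complexConj L) hw) (placeForm H w.1)) :
              GL (Fin N) (w.1.adicCompletion L)) : Matrix (Fin N) (Fin N) (w.1.adicCompletion L)).charpoly =
                p.map (algebraMap L (w.1.adicCompletion L)) →
          (redMat (((localNonsplitEquiv (IsCMField.complexConj L) H hc w hw g :
              unitaryGroupOfForm (galAdicCompletionMap (L := L) (IsCMField.complexConj L) hw) (placeForm H w.1)) :
                GL (Fin N) (w.1.adicCompletion L)) : Matrix (Fin N) (Fin N) (w.1.adicCompletion L))).charpoly.Separable :=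
  eventually_forall_separable_redMat_localNonsplitEquiv_of_charpoly_eq (IsCMField.complexConj L) N H hc p hp

end CM

end UnitaryGroup

end Literature.NumberTheory.Automorphic

end
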